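import Summits.QuantumFields.YangMills.Theorems.BalabanUVNodesN15VectorPieceEntriesDeriv
import HarnessLib

/-!
# Route «BalabanUVNodes» (K4 «SpineRates»), node N15 = NE2, -a lane, part 17: THE NODE-VOCABULARY READOUT OF THE VECTOR SINGLE-SCALE PIECE —
# `T4EtaRate.NE2ZeroOperator` ∕ the node's first conjunct `NE2PlusOperator` BY NAME on a realised paired-instance family, MODULO THE FOURTH (3.42) ENTRY

Cell `pub-ymgap`, seat `pub-ymgap-dag-n15-a` (KNIT-BY-NAME, generation g4; HUMAN RULING D-0062; chair R424 venue; `bears_on: R4∕N15`).  Filed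
`--supports stmt-QuantumFields-19351` (helper).  Imports part 16 (`hasMaj_threeEntries`) and through it part 15's plumbing and n15-b's `…N15.OperatorReadout`
(`opGeo`, `opFamily`, `etaRateIneq342_of_hasMaj`, `rateFactor_opGeo`) BY NAME; nothing in the tree modified.

THE POINT (N15-DOSSIER §6: «the node-vocabulary readout of the vector piece needs all FOUR (3.42) entries … entry 3 `Δ_UG′` (second differences) has NO
printed∕tree input — located, not claimed»).  This file builds the REALISED paired-instance family of the piece — index `VecIndex d L` = (unit torus `Π ℤ∕M_ν`
with `L ∣ M_ν`, levels `k`, `m ≥ 1`, direction `ν`); coarse∕fine geometries = `opGeo` over `unitTorusGeo L k M` ∕ `unitTorusGeo L (k+m) M` with the fine 1-forms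
as arguments (sup norm, cube supports); the η-pairing = scale shift `m`, identity on sites, King's pull-back of test 1-forms; one-point backgrounds — and the
kernel families `opFamily` of the FOUR entry operators `![entry0, entry1 ν, entry2 ν, T3]`, where **`T3` (the piece's `Δ_UG′`) is the consumer's**; and proves:
`etaRateIneq342_vec` (one index: four block majorants `B·(L^k)^{−γ₀}·e^{−δ₀|y−y′|_T}` ⇒ `EtaRateIneq342` with `(B, δ₀, γ₀)` — every site has physical size
`L^kη = 1`, so the (3.42) prefactors are `1` and the max-rate-factor is `(L^k)^{−γ₀}`), **`ne2ZeroOperator_vec_of_entry3`** (if `T3 i` has majorants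
`B₃·(L^k)^{−γ₃}·e^{−δ₃|y−y′|_T}` with uniform `γ₃, δ₃ > 0`, then `NE2ZeroOperator (vecInstance hL) (vecFamily hL T3)` — entries 0–2 by part 16 at
`α = γ = ½`, rate exponent `min(¼, γ₃)`, decay `min(δ₀, δ₃)`), **`ne2PlusOperator_vec_of_entry3`** (the node's FIRST CONJUNCT by name at the one-point
background carrier; the «+» block is inert there — the content is NE2⁰'s, said).

WHAT ENTRY 3 NEEDS (located, NOT claimed; the successor input).  The tree's Euler–Lagrange identity `B5Hk163RDiv.dftV_DstarD_HkOp_of_ne∕_zero`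
(`((Δ−∂∂*)H_kB)^_κ(p′+l) = c_Q⁻¹·conj(u v_κ)(p′+l)·w_κ(p′)`, [Balaban1984PropagatorsI] p.27∕p.29, (1.50)) gives `(Δ−∂∂*)H_k = Q_k*·W_k` with `W_k` the
unit-lattice Lagrange-multiplier operator (symbol `B5Hk163RDiv.wT`, `n`-dependence only through `φ^{(n)}` (1.62)); hence the piece's fourth entry
`(Δ−∂∂*)G = Q_k*·W_k·C^{(k)}·(η^{d+1}H_kᵀ)` and its η-defect reduce to the decay + two-lattice rate of `W_k`'s kernel — a NEW estimate, not in the tree.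

HONEST FRAMING ∕ LIMITS.  `U = 1` linear theory on finite tori; one single-scale piece in King's (4.42) shape, NOT [B6]'s multiscale expansion (NODE 00),
NOT the telescoping over `j`; the [B9] size parameter `M` of the realised geometries is INERT (`= 1`, so the guard `M₅ ≤ M` reads `M₅ = 1`); the Hölder ∕ L² ∕
global sorts of the kernel family are inert (`opFamily`); the fourth entry is a DISPLAYED BINDER (a vacuous `T3 := 0` would satisfy it — the theorem is
honest only for the intended `T3`, which is why it is a binder and not a choice); NE2⁺ NOT PRINTED ∕ not proved; count-neutral (typed 28∕28 · discharged
unchanged); NOT a discharge of N15; one finite T⁴ at fixed ε — NOT infinite volume, NOT OS on ℝ⁴, NOT a mass gap, NOT Clay.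
-/

noncomputable section

open scoped BigOperators
open Finset

namespace Summit.QuantumFields.YangMills.BalabanUVNodes.N15.VectorPiece

open Literature.MathematicalPhysics.QuantumFieldTheory.Balaban1983to89
open Literature.MathematicalPhysics.QuantumFieldTheory.Balaban1983to89.B11SectG (BlockNorm HasMaj)
open Literature.MathematicalPhysics.QuantumFieldTheory.Balaban1983to89.T4EtaRate (PairedInstance EtaPairing EtaRateIneq342 NE2PlusOperator
  NE2ZeroOperator rateFactor)
open Literature.MathematicalPhysics.QuantumFieldTheory.Balaban1983to89.T4EtaRateDefect (idef rateWeight)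
open Literature.MathematicalPhysics.QuantumFieldTheory.Balaban1983to89.T4EtaRateDefectSite (pt9Bg)
open Literature.MathematicalPhysics.QuantumFieldTheory.Balaban1983to89.T4EtaRateCoeffDefect (pull)
open Literature.MathematicalPhysics.QuantumFieldTheory.Balaban1983to89.B4TorusKernel (periodConst)
open Literature.MathematicalPhysics.QuantumFieldTheory.Balaban1983to89.B5Prop11Plancherel (Tor fine fdiff)
open Literature.MathematicalPhysics.QuantumFieldTheory.Balaban1983to89.B5Hk163Strip (kappa163 kappa163_pos)
open Literature.MathematicalPhysics.QuantumFieldTheory.Balaban1983to89.B5Hk163Decay (MG163)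
open Literature.MathematicalPhysics.QuantumFieldTheory.Balaban1983to89.B5Hk163Torus (HkOp)
open Literature.MathematicalPhysics.QuantumFieldTheory.Balaban1983to89.B5Hk163TorusHolderDecay (MD163)
open Literature.MathematicalPhysics.QuantumFieldTheory.Balaban1983to89.B5Hk163RateSum (C0maj C1maj T163)
open Literature.MathematicalPhysics.QuantumFieldTheory.Balaban1983to89.T4Hk163StripRate (CGe)
open Literature.MathematicalPhysics.QuantumFieldTheory.Balaban1983to89.B6LowerBound2153Torus (rep rep_mem_pbox)
open Literature.MathematicalPhysics.QuantumFieldTheory.Balaban1983to89.B6Lemma24Torus (pbox)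
open Literature.MathematicalPhysics.QuantumFieldTheory.Balaban1983to89.B6Cov2156Torus (deltaPol bondReductionT)
open Literature.MathematicalPhysics.QuantumFieldTheory.Balaban1983to89.B6UnitTorusCarrier (unitTorusGeo unitTorusGeo_len)
open Literature.MathematicalPhysics.QuantumFieldTheory.King1986 (aliasConst)
open Literature.MathematicalPhysics.QuantumFieldTheory.King1986.Torus (tdistT tdistT_nonneg)
open Summit.QuantumFields.YangMills.BalabanUVNodes.N15.OperatorReadout (opGeo opFamily opGeo_len rateFactor_opGeo etaRateIneq342_of_hasMaj)
open Summit.QuantumFields.YangMills.BalabanUVNodes.N15.DefectKernel (hasMaj_idef_vectorPiece_unitTorus hasMaj_idef_vectorPieceDeriv_unitTorus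
  hasMaj_idef_vectorPieceAdjDeriv_unitTorus)

variable {d : ℕ}

/-! ## §4 The realised paired-instance family of the vector piece and the NODE-VOCABULARY READOUT modulo the fourth entry -/

section Family

/-- THE INDEX of the vector-piece family at block factor `L` in dimension `d + 1`: a unit torus `Π ℤ∕M_ν` with `L ∣ M_ν`, the coarse run's number of
scales `k` (`η = L^{−k}`), the scale shift `m ≥ 1` (`η′ = L^{−m}η`), and the direction `ν` of the derivative entries. [folklore] -/
structure VecIndex (d L : ℕ) where
  /-- the period vector of the unit torus (positive naturals) -/
  M : Fin (d + 1) → ℕ+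
  /-- `L ∣ M_ν` (the (2.156) lineage's divisibility) -/
  dvd : ∀ μ, L ∣ (M μ : ℕ)
  /-- number of scales of the coarse run -/
  k : ℕ
  /-- scale shift to the fine run -/
  m : ℕ
  /-- `m ≥ 1` -/
  one_le : 1 ≤ m
  /-- direction of the derivative entries -/
  ν : Fin (d + 1)

/-- The period vector as natural numbers (every period is `NeZero` through the `ℕ+` coercion). [folklore] -/
abbrev VecIndex.Mn {d L : ℕ} (i : VecIndex d L) : Fin (d + 1) → ℕ := fun μ => (i.M μ : ℕ)

/-- The index type is inhabited (e.g. `M ≡ L`, `k = 0`, `m = 1`, `ν = 0`). [folklore] -/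
theorem vecIndex_nonempty (d L : ℕ) [NeZero L] : Nonempty (VecIndex d L) :=
  ⟨{ M := fun _ => ⟨L, Nat.pos_of_ne_zero (NeZero.ne L)⟩, dvd := fun _ => dvd_rfl, k := 0, m := 1, one_le := le_rfl, ν := 0 }⟩

variable {L : ℕ} [NeZero L]

/-- THE COARSE REALISED GEOMETRY at an index: n15-b's `opGeo` over the one-scale [B6] carrier `unitTorusGeo L k M` (sites = the unit torus, King's
`tdistT`, `η = L^{−k}`, every site of physical size `1`), arguments = real fine 1-forms at level `k` blocked by the unit block of their base point.
[cite: Balaban1985BackgroundPropagators, (3.42) p.397 («supp λ ⊂ Δ(y′)», «x ∈ Δ(y)»: typing template)] -/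
@[reducible] def vecGeoC (i : VecIndex d L) : B9.Geometry :=
  opGeo (unitTorusGeo L i.k i.Mn) (Tor (fine (L ^ i.k) i.Mn) × Fin (d + 1)) (blkFine L i.k i.Mn)

/-- THE FINE REALISED GEOMETRY at an index: the same over `unitTorusGeo L (k + m) M` with the level-`k + m` fine 1-forms, blocked through King's pairing.
[cite: Balaban1985BackgroundPropagators, (3.42) p.397 (typing template)] -/
@[reducible] def vecGeoF (i : VecIndex d L) : B9.Geometry :=
  opGeo (unitTorusGeo L (i.k + i.m) i.Mn) (Tor (fine (L ^ i.m * L ^ i.k) i.Mn) × Fin (d + 1)) (blkFine L i.k i.Mn ∘ kingPrV L i.k i.m i.Mn)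

/-- THE η-PAIRING of the two realised geometries (NOT PRINTED data, `T4EtaRate.EtaPairing`): scale shift `m`, identity on sites, King's pull-back of
test 1-forms along the bond pairing (`τλ = λ ∘ prV`: supports and sup norms preserved), one-point backgrounds. [cite: King1986, p.664 (convention before Prop. 3.8)] -/
def vecPairing (hL : 1 ≤ L) (i : VecIndex d L) : EtaPairing (vecGeoC i) (vecGeoF i) pt9Bg pt9Bg where
  n := i.m
  k_eq := rfl
  L_eq := rfl
  M_eq := rfl
  eta_eq := by
    have hL0 : (L : ℝ) ≠ 0 := Nat.cast_ne_zero.mpr (by omega)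
    show (((L : ℝ) ^ (i.k + i.m)))⁻¹ * (L : ℝ) ^ i.m = (((L : ℝ) ^ i.k))⁻¹
    rw [pow_add, mul_inv, mul_assoc, inv_mul_cancel₀ (pow_ne_zero _ hL0), mul_one]
  ι := fun y => y
  scale_ι := fun _ => rfl
  dist_ι := fun _ _ => rfl
  τ := fun lam => pull (kingPrV L i.k i.m i.Mn) lam
  suppIn_τ := fun _ _ h x' hx' => h _ hx'
  supNorm_τ := fun lam => by
    show (⨆ x' : Tor (fine (L ^ i.m * L ^ i.k) i.Mn) × Fin (d + 1), |lam (kingPrV L i.k i.m i.Mn x')|)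
      ≤ ⨆ x : Tor (fine (L ^ i.k) i.Mn) × Fin (d + 1), |lam x|
    exact ciSup_le fun x' => le_ciSup (Finite.bddAbove_range fun x => |lam x|) (kingPrV L i.k i.m i.Mn x')
  avg := fun U => U
  avg_one := rfl

/-- THE REALISED PAIRED-INSTANCE FAMILY of the vector single-scale piece (coarse∕fine realised geometries, one-point backgrounds, the pairing above).
[cite: Balaban1985BackgroundPropagators, Thm 3.14 pp.426–427 (typing template)] -/
def vecInstance (hL : 1 ≤ L) (i : VecIndex d L) : PairedInstance :=
  ⟨vecGeoC i, vecGeoF i, pt9Bg, pt9Bg, vecPairing hL i⟩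

/-- THE FOUR ENTRY OPERATORS at an index: entries 0–2 are §2's concrete η-difference operators of the piece; ENTRY 3 (`Δ_UG′`) is SUPPLIED BY THE
CONSUMER (`T3`) — its estimate is the located open input of this chain. [cite: Balaban1985BackgroundPropagators, (3.42) p.397 (the four entries)] -/
def vecOps (T3 : ∀ i : VecIndex d L, (Tor (fine (L ^ i.k) i.Mn) × Fin (d + 1) → ℝ) →ₗ[ℝ] (Tor (fine (L ^ i.m * L ^ i.k) i.Mn) × Fin (d + 1) → ℝ))
    (i : VecIndex d L) :
    Fin 4 → Unit → ((Tor (fine (L ^ i.k) i.Mn) × Fin (d + 1) → ℝ) →ₗ[ℝ] (Tor (fine (L ^ i.m * L ^ i.k) i.Mn) × Fin (d + 1) → ℝ)) :=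
  fun n _ => ![entry0 (d := d) L i.k i.m i.Mn, entry1 (d := d) L i.k i.m i.Mn i.ν, entry2 (d := d) L i.k i.m i.Mn i.ν, T3 i] n

/-- THE KERNEL FAMILIES of the realised instances: n15-b's `opFamily` (entry `e n U λ y` = sup over the fine cube `y` of `|T_n λ|`).
[cite: Balaban1985BackgroundPropagators, (3.42) p.397 (the four sup entries: shape)] -/
def vecFamily (hL : 1 ≤ L)
    (T3 : ∀ i : VecIndex d L, (Tor (fine (L ^ i.k) i.Mn) × Fin (d + 1) → ℝ) →ₗ[ℝ] (Tor (fine (L ^ i.m * L ^ i.k) i.Mn) × Fin (d + 1) → ℝ))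
    (i : VecIndex d L) : B9.KernelFamily (vecInstance hL i).gc (vecInstance hL i).Bf :=
  show B9.KernelFamily (vecGeoC i) pt9Bg from
    opFamily (g := unitTorusGeo L i.k i.Mn) (blkFine L i.k i.Mn) (blkFine L i.k i.Mn ∘ kingPrV L i.k i.m i.Mn) (vecOps T3 i)

/-- **THE READOUT, ONE INDEX, ONE CONFIGURATION.**  If the four entry operators have block majorants `B·(L^k)^{−γ₀}·e^{−δ₀|y−y′|_T}` on the unit-torus
carrier, then the realised kernel family satisfies `T4EtaRate.EtaRateIneq342` with `(B, δ₀, γ₀)` — the (3.42) prefactors are all `1` (every site has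
physical size `L^kη = 1`) and the max-rate-factor is `(L^k)^{−γ₀}`. [cite: Balaban1985BackgroundPropagators, Thm 3.1 (3.42) p.397 (shape)] -/
theorem etaRateIneq342_vec (hL : 1 ≤ L)
    (T3 : ∀ i : VecIndex d L, (Tor (fine (L ^ i.k) i.Mn) × Fin (d + 1) → ℝ) →ₗ[ℝ] (Tor (fine (L ^ i.m * L ^ i.k) i.Mn) × Fin (d + 1) → ℝ))
    (i : VecIndex d L) {B δ₀ γ₀ : ℝ} (hB : 0 ≤ B)
    (h : ∀ n : Fin 4, HasMaj (BlockNorm.ofBlocks (unitTorusGeo L i.k i.Mn) (blkFine L i.k i.Mn))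
      (BlockNorm.ofBlocks (unitTorusGeo L i.k i.Mn) (blkFine L i.k i.Mn ∘ kingPrV L i.k i.m i.Mn)) (vecOps T3 i n ())
      (fun y y' => B * ((L : ℝ) ^ i.k) ^ (-γ₀) * Real.exp (-(δ₀ * tdistT i.Mn y y')))) :
    EtaRateIneq342 (vecFamily hL T3 i) B δ₀ γ₀ () := by
  have hL0 : L ≠ 0 := by omega
  have hLr : (0 : ℝ) < (L : ℝ) := by exact_mod_cast (show 0 < L by omega)
  have hη : (unitTorusGeo L i.k i.Mn).eta ≠ 0 := inv_ne_zero (pow_ne_zero _ hLr.ne')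
  show EtaRateIneq342 (opFamily (g := unitTorusGeo L i.k i.Mn) (B := pt9Bg) (blkFine L i.k i.Mn) (blkFine L i.k i.Mn ∘ kingPrV L i.k i.m i.Mn)
    (vecOps T3 i)) B δ₀ γ₀ ()
  refine etaRateIneq342_of_hasMaj (g := unitTorusGeo L i.k i.Mn) (B := pt9Bg) (blkFine L i.k i.Mn) (blkFine L i.k i.Mn ∘ kingPrV L i.k i.m i.Mn)
    (inv_nonneg.mpr (pow_nonneg hLr.le _)) hLr.le hB (vecOps T3 i) () fun n => (h n).mono fun y y' => le_of_eq ?_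
  have hp : B9.pref4 (1 : ℝ) n = 1 := by fin_cases n <;> simp [B9.pref4]
  rw [opGeo_len, unitTorusGeo_len L i.k i.Mn hL0, hp, mul_one, rateFactor_opGeo _ _ _ hη hLr, rateFactor_opGeo _ _ _ hη hLr]
  show _ = B * Real.exp (-(δ₀ * tdistT i.Mn y y')) * max (((L : ℝ) ^ i.k) ^ (-γ₀)) (((L : ℝ) ^ i.k) ^ (-γ₀))
  rw [max_self]
  ring

/-- **NE2⁰, OPERATOR LAYER, FOR THE VECTOR SINGLE-SCALE PIECE — MODULO THE FOURTH ENTRY.**  For `d + 1 ≥ 2`, `L ≥ 1`: if the consumer's fourth-entry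
operators `T3 i` (`Δ_UG′` of the piece) have block majorants `B₃·(L^k)^{−γ₃}·e^{−δ₃|y−y′|_T}` with UNIFORM `B₃`, `γ₃ > 0`, `δ₃ > 0`, then the
realised paired-instance family of the piece satisfies `T4EtaRate.NE2ZeroOperator` BY NAME — entries 0–2 are §3's theorems (rate exponent
`min(min(α,γ)∕2, γ₃)`, decay `min(δ₀, δ₃)`), nothing else is assumed.  `U ≡ 1`: the one-point background carrier.
[cite: Balaban1985BackgroundPropagators, Thm 3.1 (3.42) p.397 (shape); King1986, Props. 3.8–3.9 (3.71)–(3.75) pp.664–665 (A = 0 model)] -/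
theorem ne2ZeroOperator_vec_of_entry3 (hd : 1 ≤ d) (hL : 1 ≤ L)
    (T3 : ∀ i : VecIndex d L, (Tor (fine (L ^ i.k) i.Mn) × Fin (d + 1) → ℝ) →ₗ[ℝ] (Tor (fine (L ^ i.m * L ^ i.k) i.Mn) × Fin (d + 1) → ℝ))
    {B₃ γ₃ δ₃ : ℝ} (hγ₃ : 0 < γ₃) (hδ₃ : 0 < δ₃)
    (h3 : ∀ i : VecIndex d L, HasMaj (BlockNorm.ofBlocks (unitTorusGeo L i.k i.Mn) (blkFine L i.k i.Mn))
      (BlockNorm.ofBlocks (unitTorusGeo L i.k i.Mn) (blkFine L i.k i.Mn ∘ kingPrV L i.k i.m i.Mn)) (T3 i)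
      (fun y y' => B₃ * ((L : ℝ) ^ i.k) ^ (-γ₃) * Real.exp (-(δ₃ * tdistT i.Mn y y')))) :
    NE2ZeroOperator (vecInstance (d := d) hL) (vecFamily hL T3) := by
  obtain ⟨B, δ₀, hB, hδ₀, H⟩ := hasMaj_threeEntries (d := d) hd hL (α := 1 / 2) (γ := 1 / 2) (by norm_num) (by norm_num) (by norm_num)
    (by norm_num)
  have hmin : min (1 / 2 : ℝ) (1 / 2) / 2 = 1 / 4 := by norm_num
  rw [hmin] at H
  refine ⟨1, min δ₀ δ₃, max B B₃, min (1 / 4) γ₃, one_pos, lt_min hδ₀ hδ₃, lt_max_of_lt_left hB, lt_min (by norm_num) hγ₃, fun i _ => ?_⟩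
  have hx1 : (1 : ℝ) ≤ (L : ℝ) ^ i.k := one_le_pow₀ (by exact_mod_cast hL)
  have hrate : ∀ {a : ℝ}, min (1 / 4) γ₃ ≤ a → ((L : ℝ) ^ i.k) ^ (-a) ≤ ((L : ℝ) ^ i.k) ^ (-min (1 / 4) γ₃) := fun ha =>
    Real.rpow_le_rpow_of_exponent_le hx1 (neg_le_neg ha)
  have hexp : ∀ {δ : ℝ} (y y' : Tor i.Mn), min δ₀ δ₃ ≤ δ → Real.exp (-(δ * tdistT i.Mn y y')) ≤ Real.exp (-(min δ₀ δ₃ * tdistT i.Mn y y')) :=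
    fun y y' hδ => Real.exp_le_exp.mpr (neg_le_neg (mul_le_mul_of_nonneg_right hδ (tdistT_nonneg _ _ _)))
  have hmono : ∀ {B' a δ : ℝ}, B' ≤ max B B₃ → min (1 / 4) γ₃ ≤ a → min δ₀ δ₃ ≤ δ → ∀ y y' : Tor i.Mn,
      B' * ((L : ℝ) ^ i.k) ^ (-a) * Real.exp (-(δ * tdistT i.Mn y y'))
        ≤ max B B₃ * ((L : ℝ) ^ i.k) ^ (-min (1 / 4) γ₃) * Real.exp (-(min δ₀ δ₃ * tdistT i.Mn y y')) :=
    fun hB' ha hδ y y' => mul_le_mul (mul_le_mul hB' (hrate ha) (Real.rpow_nonneg (by positivity) _) ((hB.le).trans (le_max_left _ _)))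
      (hexp y y' hδ) (Real.exp_nonneg _) (mul_nonneg ((hB.le).trans (le_max_left _ _)) (Real.rpow_nonneg (by positivity) _))
  obtain ⟨h₀, h₁, h₂⟩ := H i.Mn i.dvd i.k i.m i.one_le i.ν
  refine etaRateIneq342_vec hL T3 i ((hB.le).trans (le_max_left _ _)) fun n => ?_
  fin_cases n
  · exact h₀.mono (hmono (le_max_left _ _) (min_le_left _ _) (min_le_left _ _))
  · exact h₁.mono (hmono (le_max_left _ _) (min_le_left _ _) (min_le_left _ _))
  · exact h₂.mono (hmono (le_max_left _ _) (min_le_left _ _) (min_le_left _ _))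
  · exact (h3 i).mono (hmono (le_max_right _ _) (min_le_right _ _) (min_le_right _ _))

/-- **NE2⁺, OPERATOR LAYER (the node's FIRST CONJUNCT `T4EtaRate.NE2PlusOperator` BY NAME) FOR THE VECTOR PIECE — MODULO THE FOURTH ENTRY**, at the
one-point background carrier (the regularity condition (3.35) is VOID there: the «+» block is inert, the content is NE2⁰'s — said, as for g0's knit).
[cite: Balaban1985BackgroundPropagators, Thm 3.1 p.397 (quantifier template)] -/
theorem ne2PlusOperator_vec_of_entry3 (hd : 1 ≤ d) (hL : 1 ≤ L) (c35 : ℝ)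
    (T3 : ∀ i : VecIndex d L, (Tor (fine (L ^ i.k) i.Mn) × Fin (d + 1) → ℝ) →ₗ[ℝ] (Tor (fine (L ^ i.m * L ^ i.k) i.Mn) × Fin (d + 1) → ℝ))
    {B₃ γ₃ δ₃ : ℝ} (hγ₃ : 0 < γ₃) (hδ₃ : 0 < δ₃)
    (h3 : ∀ i : VecIndex d L, HasMaj (BlockNorm.ofBlocks (unitTorusGeo L i.k i.Mn) (blkFine L i.k i.Mn))
      (BlockNorm.ofBlocks (unitTorusGeo L i.k i.Mn) (blkFine L i.k i.Mn ∘ kingPrV L i.k i.m i.Mn)) (T3 i)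
      (fun y y' => B₃ * ((L : ℝ) ^ i.k) ^ (-γ₃) * Real.exp (-(δ₃ * tdistT i.Mn y y')))) :
    NE2PlusOperator c35 (vecInstance (d := d) hL) (vecFamily hL T3) := by
  obtain ⟨M₅, δ₀, B₀, γ₀, hM₅, hδ₀, hB₀, hγ₀, H⟩ := ne2ZeroOperator_vec_of_entry3 (d := d) hd hL T3 hγ₃ hδ₃ h3
  exact ⟨M₅, δ₀, 1, B₀, γ₀, hM₅, hδ₀, one_pos, hB₀, hγ₀, fun i hM _ _ _ U _ => by cases U; exact H i hM⟩

end Family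

end Summit.QuantumFields.YangMills.BalabanUVNodes.N15.VectorPiece
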